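import Literature.Probability.LatticeModels.UrsellInversion
import Mathlib.Algebra.BigOperators.Ring.Finset
import HarnessLib

/-!
# Cumulants of a moment sequence and the moment–cumulant recursion

Topic `Literature/Probability/LatticeModels`; continues `UrsellInversion.lean`.  Transport of the
Ursell function along embeddings (`ursellOf_map`, as `hcUrsell_map` of `HardCoreUrsell`) and the
symmetric case in which the moment of a set depends only on its cardinality: the **cumulants**
`cumulantOf μ k` of a moment sequence `μ : ℕ → C` (`μ 0 = 1`), i.e. the truncated expectations
`𝓔ᵀ(X; k)` of one commuting variable with moments `μ k = 𝓔(Xᵏ)` (Mastropietro 2008, (2.34)–(2.36);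
Benfatto–Giuliani–Mastropietro 2006, (2.14): `𝓔ᵀ₁(V₁; n) = ∂ⁿ_λ log ∫P e^{λV₁}|₀`), and the
**moment–cumulant recursion** `μₙ₊₁ = Σₖ C(n,k) κₖ₊₁ μₙ₋ₖ`, which is the coefficient form of
`M' = K'M`, `M = exp K` for the exponential generating functions (Ruelle 1969, (4.5)–(4.7):
`ψ = Γφ` with `Γ` the exponential for the product `*`), i.e. of
`log ∫P(dψ) e^{X} = Σₙ 𝓔ᵀ(X; n)/n!` ((2.36) of Mastropietro) at the level of formal power series.

## Main results

* `ursellOf_map` — `(m ∘ map e)ᵀ(V) = mᵀ(e V)` for an embedding `e`;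
* `cumulantOf μ k` (a `def`) and `ursellOf_card` — the Ursell function of `P ↦ μ(#P)` at `V` is
  `cumulantOf μ (#V)`;
* `cumulantOf_one` (`κ₁ = μ₁`), `cumulantOf_two` (`κ₂ = μ₂ - μ₁²`);
* `moment_succ_eq_sum_choose_mul_cumulantOf` — `μ (n+1) = Σ_{k ≤ n} C(n,k) κ (k+1) μ (n-k)`.

## Sources

D. Ruelle, *Statistical Mechanics: Rigorous Results* (1969), §4.4.1, (4.5)–(4.7), PDF p. 77 of the
held copy; bib key `Ruelle1969`.  V. Mastropietro, *Non-Perturbative Renormalization* (2008),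
§2.3, (2.32)–(2.36), PDF pp. 34–35 of the held copy; bib key `Mastropietro2008`.

## Proof of the recursion

Block decomposition of the cluster expansion of `μ(n+1) = m(range (n+1))` at the vertex `0`
(`sum_ursellOf_mul_eq`): the block `P₀ ∋ 0` of size `k+1` contributes `κₖ₊₁ μₙ₋ₖ`
(`ursellOf_card`), and there are `C(n,k)` of them (`Finset.sum_powerset_apply_card` after
`P₀ = insert 0 Q`).
-/

open Finset

namespace Literature.Probability.LatticeModels

variable {α : Type*} [DecidableEq α] {β : Type*} [DecidableEq β] {C : Type*} [CommRing C]

/-- **Transport of the Ursell function along an embedding**: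
`(m ∘ map e)ᵀ(V) = mᵀ(e V)`. [folklore] -/
theorem ursellOf_map (e : α ↪ β) (m : Finset β → C) (V : Finset α) :
    ursellOf (fun P : Finset α => m (P.map e)) V = ursellOf m (V.map e) := by
  induction V using Finset.strongInduction with
  | H V ih =>
    rw [ursellOf_eq, ursellOf_eq]
    congr 1
    have hsing : ({V.map e} : Finset (Finset β)) =
        (mapEmbedding (mapEmbedding e).toEmbedding).toEmbedding {V} := by
      rw [RelEmbedding.coe_toEmbedding, mapEmbedding_apply, map_singleton]; rfl
    rw [setPartitions_map, hsing, ← map_erase, sum_map]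
    refine sum_congr rfl fun π hπ => ?_
    simp only [RelEmbedding.coe_toEmbedding, mapEmbedding_apply]
    rw [prod_map]
    refine prod_congr rfl fun P hP => ?_
    simp only [RelEmbedding.coe_toEmbedding, mapEmbedding_apply]
    obtain ⟨hne, hπ'⟩ := mem_erase.1 hπ
    exact ih P ((mem_setPartitions.1 hπ').ssubset_of_ne_singleton hne hP)

/-- **The cumulants** of a moment sequence `μ : ℕ → C` (the symmetric case of `ursellOf`: the
moment of a set depends only on its cardinality): `κ k = mᵀ(V)` for any `V` with `#V = k`,
`m(P) = μ(#P)` (`ursellOf_card`), i.e. the truncated expectations `𝓔ᵀ(X; k)` of a single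
(commuting) variable with moments `μ k = 𝓔(Xᵏ)` (Mastropietro 2008, (2.34)–(2.35); Benfatto–
Giuliani–Mastropietro 2006, (2.14)). [folklore] -/
def cumulantOf (μ : ℕ → C) (k : ℕ) : C :=
  ursellOf (fun P : Finset (Fin k) => μ P.card) univ

/-- The Ursell function of a cardinality-dependent moment function is the cumulant of the
cardinality. [folklore] -/
theorem ursellOf_card (μ : ℕ → C) (V : Finset α) :
    ursellOf (fun P : Finset α => μ P.card) V = cumulantOf μ V.card := by
  -- transport along the enumeration `Fin #V ↪ α` of `V`
  set e : Fin V.card ↪ α := V.equivFin.symm.toEmbedding.trans (Function.Embedding.subtype _) with he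
  have hV : (univ : Finset (Fin V.card)).map e = V := by
    ext x
    simp only [mem_map, mem_univ, true_and, he, Function.Embedding.trans_apply,
      Equiv.coe_toEmbedding, Function.Embedding.coe_subtype]
    constructor
    · rintro ⟨i, rfl⟩; exact (V.equivFin.symm i).2
    · intro hx; exact ⟨V.equivFin ⟨x, hx⟩, by simp⟩
  rw [cumulantOf]
  conv_lhs => rw [← hV]
  rw [← ursellOf_map e (fun P : Finset α => μ P.card)]
  simp only [card_map]

/-- `κ 1 = μ 1` (`𝓔ᵀ(X;1) = 𝓔(X)`, Mastropietro (2.34)). [folklore] -/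
theorem cumulantOf_one (μ : ℕ → C) : cumulantOf μ 1 = μ 1 := by
  have h := ursellOf_card μ ({0} : Finset ℕ)
  rw [ursellOf_singleton, card_singleton] at h
  exact h.symm

/-- `κ 2 = μ 2 - (μ 1)²` (the variance). [folklore] -/
theorem cumulantOf_two (μ : ℕ → C) (hμ : μ 0 = 1) : cumulantOf μ 2 = μ 2 - μ 1 * μ 1 := by
  have h := ursellOf_card μ ({0, 1} : Finset ℕ)
  rw [ursellOf_pair (fun P : Finset ℕ => μ P.card) (by simpa using hμ) (by decide), card_pair (by decide),
    card_singleton, card_singleton] at h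
  exact h.symm

/-- **The moment–cumulant recursion** (equivalently `M' = K' M` for the exponential generating
functions `M = Σ μₙ tⁿ/n!`, `K = Σ κₙ tⁿ/n!`, i.e. `M = exp K`: Ruelle 1969, (4.5)–(4.7);
Mastropietro 2008, (2.36) `log ∫P(dψ)e^{X} = Σₙ 𝓔ᵀ(X;n)/n!`): for `μ 0 = 1`,
`μ (n+1) = Σ_{k=0}^{n} C(n,k) κ_{k+1} μ_{n-k}`. [cite: Ruelle1969, §4.4.1 (4.5)-(4.7)] -/
theorem moment_succ_eq_sum_choose_mul_cumulantOf (μ : ℕ → C) (hμ : μ 0 = 1) (n : ℕ) :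
    μ (n + 1) = ∑ k ∈ range (n + 1), (n.choose k : C) * cumulantOf μ (k + 1) * μ (n - k) := by
  -- block decomposition of `m(range (n+1))` at the vertex `0`
  have h := sum_ursellOf_mul_eq (fun P : Finset ℕ => μ P.card) (by simpa using hμ)
    (W := range (n + 1)) (v := 0) (by simp)
  rw [card_range] at h
  rw [← h]
  -- reindex `P₀ = insert 0 Q`, `Q ⊆ {1, …, n}`
  have hbij : ∑ P₀ ∈ (range (n + 1)).powerset.filter (fun P => 0 ∈ P),
      ursellOf (fun P : Finset ℕ => μ P.card) P₀ * μ ((range (n + 1)) \ P₀).card =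
      ∑ Q ∈ ((range (n + 1)).erase 0).powerset,
        cumulantOf μ (Q.card + 1) * μ (n - Q.card) := by
    refine sum_nbij' (fun P₀ => P₀.erase 0) (fun Q => insert 0 Q) ?_ ?_ ?_ ?_ ?_
    · intro P₀ hP₀
      simp only [mem_filter, mem_powerset] at hP₀ ⊢
      exact erase_subset_erase 0 hP₀.1
    · intro Q hQ
      simp only [mem_filter, mem_powerset] at hQ ⊢
      exact ⟨insert_subset (by simp) (hQ.trans (erase_subset _ _)), mem_insert_self _ _⟩
    · intro P₀ hP₀
      exact insert_erase (mem_filter.1 hP₀).2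
    · intro Q hQ
      have h0 : (0 : ℕ) ∉ Q := fun h => by simpa using (mem_powerset.1 hQ) h
      exact erase_insert h0
    · intro P₀ hP₀
      obtain ⟨hP₀, h0⟩ := mem_filter.1 hP₀
      have hsub := mem_powerset.1 hP₀
      rw [ursellOf_card, card_sdiff_of_subset hsub, card_range]
      have hc : (P₀.erase 0).card + 1 = P₀.card := card_erase_add_one h0
      have hle : P₀.card ≤ n + 1 := (card_le_card hsub).trans (by rw [card_range])
      rw [hc]
      congr 2
      omega
  rw [hbij, Finset.sum_powerset_apply_card (fun k => cumulantOf μ (k + 1) * μ (n - k)),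
    card_erase_of_mem (by simp), card_range, Nat.add_sub_cancel]
  refine sum_congr rfl fun k _ => ?_
  rw [nsmul_eq_mul, mul_assoc]

end Literature.Probability.LatticeModels
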